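import Summits.NavierStokesRegularity.NavierStokesRegularity.Theorems.RungBlowupCofinal.BandLimitedCurl
import Summits.NavierStokesRegularity.NavierStokesRegularity.Theorems.RungBlowupCofinal.PureWaveExclusion
import Summits.NavierStokesRegularity.FluidComputer.AngularGalerkinLadderRotation
import Literature.Analysis.FluidPDE.IsometryInvariance
import Literature.Analysis.FluidPDE.AxisymNoSwirlScalarEq
import Literature.Analysis.FluidPDE.SwirlTransportProofs
import Literature.Analysis.FluidPDE.AxisymmetricReflection
import HarnessLib

/-!
# SWIRL-ONLY (toroidal zonal) rung profiles are excluded — for EVERY precession rate `α` and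
# EVERY level `L`: reflection parity splits the profile equation, the linear residual is a
# tangential gradient, hence zero, and the pure-wave Liouville theorem finishes
# (route `AngularGalerkinLadder`, crux K1 `RungBlowupCofinal`; admissibility filter N6, theorems only)

Cell `ns-blowup`, seat `ns-blowup-circuit` (g12, AGL Lean seat). Helper file for
`stmt-NavierStokesRegularity-19959`, line `Cruxes/RungBlowupCofinal/Lines/qlwave.lean`, series of
kernel admissibility filters (N1 `PureWaveExclusion` … N5 `BandClosedNonlinearityExcluded`). N5
excluded the RADIAL swirl `Ω(‖y‖²)·e₃ × y` inside the Pineau–Vicol window; this file excludes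
the GENERAL axisymmetric swirl-only field `U(y) = f(y)·Jy`, `J y = e₃ × y = (−y₁, y₀, 0)`
(`Literature…rotGen`), `f` smooth and axisymmetric — the whole TOROIDAL half of the open
pure-zonal exclusion — with NO window in `α`.

## The argument (`eq_zero_of_reflectionOdd`)

Let `−ΔU + ½U + ½DU·y + αJ₃U + (U·∇)U + ∇Q = E`, `U` band-limited (degree `≤ L`), divergence
free, `J₃U = 0`, `E` co-band-limited, `‖U(y)‖ ≤ C/(‖y‖+1)`, and let `σ` be a linear isometry
with `σ ∘ U ∘ σ⁻¹ = −U` (U is `σ`-ODD) while `σ ∘ (U·∇)U ∘ σ⁻¹ = (U·∇)U` (the nonlinearity is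
`σ`-EVEN); suppose `U` and `ΔU` are tangential (`⟪U(y), y⟫ = ⟪ΔU(y), y⟫ = 0`). Then `U = 0`:
1. the linear residual `G = −ΔU + ½U + ½DU·y` is `σ`-odd (Laplacian and radial derivative
   commute with isometries: `laplacian_conj_linearIsometryEquiv`, `fderiv_conj_linearIsometryEquiv`)
   and band-limited (`isBandLimited_profileOp`);
2. reflecting the equation and subtracting: `G + ∇Q_odd = E_odd` with `E_odd = ½(E − σEσ⁻¹)`
   co-band-limited (`IsCobandLimited.conj_linearIsometryEquiv`) ⇒ `curl G = 0`
   (`curl_eq_zero_of_add_gradient_eq_coband`) ⇒ `G = ∇ψ` (`exists_smooth_gradient_eq`);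
3. `⟪∇ψ(y), y⟫ = ⟪G(y), y⟫ = 0` ⇒ `ψ` is constant along every ray from the origin ⇒ `ψ ≡ ψ(0)`
   ⇒ `G = 0` (`eq_of_inner_gradient_eq_zero`);
4. `G = 0` is the pure-wave linear profile equation with ZERO defect ⇒ `U = 0`
   (`eq_zero_of_linearProfile`, N1, via the ancient Stokes Liouville theorem).

## The swirl-only field (`swirlOnly_eq_zero`)

For `U = f·J` with `f` smooth axisymmetric (`IsAxisymmetricScalar f`): `J₃U = 0`
(`angGen_two_smul_rotGen`), `(U·∇)U = f²·J(Jy)` (`convect_smul_rotGen_self`, centripetal),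
`⟪U, y⟫ = 0`, `⟪ΔU, y⟫ = 0` (`laplacian_smul_rotGen`: `ΔU = (Δf)Jy + 2J∇f` and `∇f ⊥ Jy`); for
any linear isometry `σ` with `σJσ⁻¹ = −J` and `f ∘ σ⁻¹ = f` (the reflection in a meridional plane
`(y₀, y₁, y₂) ↦ (y₀, −y₁, y₂)` is one: the tree's `reflY`, §5, `reflY_rotGen_reflY`,
`IsAxisymmetricScalar.comp_reflY_symm` via `exists_rotZ_eq_reflY`) `U` is `σ`-odd and `f²J²` is
`σ`-even. Hence **`swirlOnly_eq_zero'`** (unconditional): such a `U` solving the precessing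
rung-profile system (any `α`, any `L`, band-limited, divergence-free, continuous co-band defect,
Type-I tail) vanishes identically; `rungProfile_swirlOnly_eq_zero` in the line's letters.

LABEL: KERNEL, unconditional. WHAT THIS IS NOT: not Navier–Stokes evidence; no profile is
constructed; zonal profiles WITH meridional circulation (poloidal part) are untouched — their
nonlinearity is neither odd nor even and the splitting fails. References: [cite: KochNadirashviliSereginSverak2009, §1 (1.5), (1.8)]
(the generator `J`, axisymmetry); [cite: MajdaBertozziCUP2002, §1.2 Prop. 1.1] (isometry
covariance); [cite: PineauVicol2026, (1.7)] (the precessing ansatz behind the profile system). -/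

noncomputable section

namespace Summit.NavierStokesRegularity.AngularGalerkinLadderSwirlOnlyProfilesExcluded

open Set Function
open scoped ContDiff RealInnerProductSpace Laplacian
open Literature.Analysis.FluidPDE
open Summit.NavierStokesRegularity.FluidComputer Summit.NavierStokesRegularity.FluidComputer.AngularLadder
open Summit.NavierStokesRegularity.AngularGalerkinLadderBandLimitedCurl
open Summit.NavierStokesRegularity.AngularGalerkinLadderPureWaveExclusion

variable {L : ℕ} {α C : ℝ}
  {U E : EuclideanSpace ℝ (Fin 3) → EuclideanSpace ℝ (Fin 3)} {Q : EuclideanSpace ℝ (Fin 3) → ℝ}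

/-- `⟪∇f(x), h⟫ = Df(x) h`. [folklore] -/
private theorem inner_gradient_left' (f : EuclideanSpace ℝ (Fin 3) → ℝ)
    (x h : EuclideanSpace ℝ (Fin 3)) : ⟪gradient f x, h⟫ = fderiv ℝ f x h := by
  rw [gradient, InnerProductSpace.toDual_symm_apply]

/-! ## §1 Reflection parity: an odd band-limited part plus an even part is curl-free -/

/-- **Parity splitting.** If `G + N + ∇Q = E` with `G` band-limited of degree `≤ L`, `E`
co-band-limited, `Q` smooth, and a linear isometry `σ` makes `G` odd (`σG(σ⁻¹y) = −G(y)`) and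
`N` even (`σN(σ⁻¹y) = N(y)`), then `curl G = 0`: reflect, subtract, and the odd part
`G + ∇Q_odd = E_odd` is band-limited-plus-gradient = co-band. [folklore] -/
theorem curl_eq_zero_of_odd_even_split
    (σ : EuclideanSpace ℝ (Fin 3) ≃ₗᵢ[ℝ] EuclideanSpace ℝ (Fin 3))
    {G N E : EuclideanSpace ℝ (Fin 3) → EuclideanSpace ℝ (Fin 3)} {Q : EuclideanSpace ℝ (Fin 3) → ℝ}
    (hG : IsBandLimited L G) (hQ : ContDiff ℝ ∞ Q) (hE : IsCobandLimited L E)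
    (hEc : Continuous E) (heq : ∀ y, G y + N y + gradient Q y = E y)
    (hGodd : ∀ y, σ (G (σ.symm y)) = -G y) (hNeven : ∀ y, σ (N (σ.symm y)) = N y) :
    curl G = 0 := by
  -- the reflected equation
  have heq' : ∀ y, -G y + N y + gradient (fun z => Q (σ.symm z)) y = σ (E (σ.symm y)) := by
    intro y
    rw [gradient_comp_linearIsometryEquiv_symm σ Q y, ← hGodd y, ← hNeven y, ← map_add,
      ← map_add, heq (σ.symm y)]
  -- the odd parts of pressure and defect
  have hQσ : ContDiff ℝ ∞ (fun z => Q (σ.symm z)) :=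
    hQ.comp σ.symm.toContinuousLinearEquiv.contDiff
  have hQ' : ContDiff ℝ ∞ (fun z => (1 / 2 : ℝ) * (Q z - Q (σ.symm z))) :=
    contDiff_const.mul (hQ.sub hQσ)
  have hE' : IsCobandLimited L (fun z => (1 / 2 : ℝ) • (E z - σ (E (σ.symm z)))) := by
    have hEσc : Continuous (fun y => σ (E (σ.symm y))) :=
      σ.continuous.comp (hEc.comp σ.symm.continuous)
    have h := (hE.add (hE.conj_linearIsometryEquiv σ).neg hEc hEσc.neg).smul (1 / 2 : ℝ)
    have e : (fun z => (1 / 2 : ℝ) • (E z - σ (E (σ.symm z)))) =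
        (1 / 2 : ℝ) • (E + -fun y => σ (E (σ.symm y))) := by
      funext z
      simp only [Pi.smul_apply, Pi.add_apply, Pi.neg_apply, sub_eq_add_neg]
    rw [e]
    exact h
  have hsplit : ∀ y, G y + gradient (fun z => (1 / 2 : ℝ) * (Q z - Q (σ.symm z))) y =
      (1 / 2 : ℝ) • (E y - σ (E (σ.symm y))) := by
    intro y
    have hd1 : DifferentiableAt ℝ Q y := (hQ.differentiable (by simp)) y
    have hd2 : DifferentiableAt ℝ (fun z => Q (σ.symm z)) y := (hQσ.differentiable (by simp)) y
    have hg : gradient (fun z => (1 / 2 : ℝ) * (Q z - Q (σ.symm z))) y =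
        (1 / 2 : ℝ) • (gradient Q y - gradient (fun z => Q (σ.symm z)) y) := by
      simp only [gradient, fderiv_const_mul (hd1.fun_sub hd2), fderiv_fun_sub hd1 hd2, map_smul,
        map_sub]
    rw [hg, ← heq y, ← heq' y]
    module
  exact curl_eq_zero_of_add_gradient_eq_coband hG hQ' hE' hsplit

/-! ## §2 A gradient orthogonal to the position vector is the gradient of a constant -/

/-- **Radial constancy.** If `ψ ∈ C¹` and `⟪∇ψ(x), x⟫ = 0` for every `x`, then `ψ(x) = ψ(0)`
for every `x` (`t ↦ ψ(tx)` has derivative `⟪∇ψ(tx), x⟫ = t⁻¹⟪∇ψ(tx), tx⟫ = 0` for `t ≠ 0`;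
mean value theorem on `[0, 1]`). [folklore] -/
theorem eq_of_inner_gradient_eq_zero {ψ : EuclideanSpace ℝ (Fin 3) → ℝ} (hψ : ContDiff ℝ 1 ψ)
    (h : ∀ x, ⟪gradient ψ x, x⟫ = 0) (x : EuclideanSpace ℝ (Fin 3)) : ψ x = ψ 0 := by
  have hψd : Differentiable ℝ ψ := hψ.differentiable one_ne_zero
  -- the restriction to the ray through `x`
  have hder : ∀ t : ℝ, HasDerivAt (fun s : ℝ => ψ (s • x)) (fderiv ℝ ψ (t • x) x) t := by
    intro t
    have h1 : HasDerivAt (fun s : ℝ => s • x) x t := by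
      simpa using (hasDerivAt_id t).smul_const x
    exact (hψd (t • x)).hasFDerivAt.comp_hasDerivAt t h1
  have hzero : ∀ t : ℝ, t ≠ 0 → fderiv ℝ ψ (t • x) x = 0 := by
    intro t ht
    have h1 : fderiv ℝ ψ (t • x) (t • x) = 0 := by
      rw [← inner_gradient_left']; exact h (t • x)
    rw [map_smul, smul_eq_mul] at h1
    exact (mul_eq_zero.1 h1).resolve_left ht
  have hcont : ContinuousOn (fun s : ℝ => ψ (s • x)) (Icc 0 1) :=
    (hψ.continuous.comp (continuous_id.smul continuous_const)).continuousOn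
  obtain ⟨c, hc, hcd⟩ := exists_hasDerivAt_eq_slope (fun s : ℝ => ψ (s • x))
    (fun t => fderiv ℝ ψ (t • x) x) zero_lt_one hcont (fun t _ => hder t)
  rw [hzero c (ne_of_gt hc.1)] at hcd
  simp only [one_smul, zero_smul, sub_zero, div_one] at hcd
  linarith

/-- **A tangential gradient field vanishes**: `G = ∇ψ` smooth with `⟪G(y), y⟫ = 0` for all `y`
forces `G = 0`. [folklore] -/
theorem eq_zero_of_gradient_tangential {G : EuclideanSpace ℝ (Fin 3) → EuclideanSpace ℝ (Fin 3)}
    {ψ : EuclideanSpace ℝ (Fin 3) → ℝ} (hψ : ContDiff ℝ ∞ ψ) (hgrad : ∀ y, gradient ψ y = G y)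
    (htan : ∀ y, ⟪G y, y⟫ = 0) : G = 0 := by
  have hconst : ∀ y, ψ y = ψ 0 :=
    eq_of_inner_gradient_eq_zero (contDiff_infty.1 hψ 1) (fun y => by rw [hgrad y]; exact htan y)
  have hψc : ψ = fun _ => ψ 0 := funext hconst
  funext y
  rw [← hgrad y, hψc]
  exact gradient_fun_const y (ψ 0)

/-! ## §3 The abstract exclusion: odd field, even nonlinearity, tangential residual -/

/-- Differentiating `⟪U(y), y⟫ ≡ 0` along `y`: `⟪DU(y) y, y⟫ = 0`. [folklore] -/
theorem inner_fderiv_self_eq_zero_of_tangential (hU : Differentiable ℝ U)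
    (htan : ∀ y, ⟪U y, y⟫ = 0) (y : EuclideanSpace ℝ (Fin 3)) : ⟪fderiv ℝ U y y, y⟫ = 0 := by
  have e : (fun z : EuclideanSpace ℝ (Fin 3) => ⟪U z, z⟫) = fun _ => (0 : ℝ) := funext htan
  have h2 : fderiv ℝ (fun z : EuclideanSpace ℝ (Fin 3) => ⟪U z, z⟫) y y = 0 := by
    rw [e]; simp
  rw [fderiv_inner_apply ℝ (hU y) differentiableAt_fun_id] at h2
  simp only [fderiv_fun_id, ContinuousLinearMap.coe_id', id, htan y, zero_add] at h2
  exact h2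

/-- **THE ABSTRACT EXCLUSION.** Let `U` be band-limited of degree `≤ L`, divergence-free, zonal
(`J₃U = 0`), tangential (`⟪U(y), y⟫ = 0`) with tangential Laplacian (`⟪ΔU(y), y⟫ = 0`), solving
`−ΔU + ½U + ½DU·y + αJ₃U + (U·∇)U + ∇Q = E` with smooth `Q`, co-band-limited `E` and the tail
`‖U(y)‖ ≤ C/(‖y‖+1)`. If some linear isometry `σ` makes `U` ODD and `(U·∇)U` EVEN, then `U = 0`
— for every `α` and every `L`. [folklore] -/
theorem eq_zero_of_reflectionOdd
    (σ : EuclideanSpace ℝ (Fin 3) ≃ₗᵢ[ℝ] EuclideanSpace ℝ (Fin 3))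
    (hU : IsBandLimited L U) (hdiv : VectorCalculus.IsDivFree U) (hQ : ContDiff ℝ ∞ Q)
    (hE : IsCobandLimited L E) (hEc : Continuous E)
    (heq : ∀ y, -(Δ U) y + (1 / 2 : ℝ) • U y + (1 / 2 : ℝ) • fderiv ℝ U y y + α • angGen 2 U y +
      convect U U y + gradient Q y = E y)
    (hdec : ∀ y, ‖U y‖ ≤ C / (‖y‖ + 1))
    (hzonal : ∀ y, angGen 2 U y = 0)
    (hodd : ∀ y, σ (U (σ.symm y)) = -U y)
    (heven : ∀ y, σ (convect U U (σ.symm y)) = convect U U y)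
    (htanU : ∀ y, ⟪U y, y⟫ = 0) (htanΔ : ∀ y, ⟪(Δ U) y, y⟫ = 0) : U = 0 := by
  have hUs : ContDiff ℝ ∞ U := hU.1
  have hUd : Differentiable ℝ U := hUs.differentiable (by simp)
  -- the linear residual, band-limited
  set G : EuclideanSpace ℝ (Fin 3) → EuclideanSpace ℝ (Fin 3) := fun y =>
    -((1 : ℝ) • (Δ U) y) + (1 / 2 : ℝ) • U y + (1 / 2 : ℝ) • fderiv ℝ U y y + α • angGen 2 U y
    with hG
  have hGb : IsBandLimited L G := isBandLimited_profileOp hU 1 α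
  have heqG : ∀ y, G y + convect U U y + gradient Q y = E y := fun y => by
    simp only [hG, one_smul]; exact heq y
  -- Step 1: `G` is `σ`-odd
  have hconj : (fun y => σ (U (σ.symm y))) = -U := funext fun y => by rw [hodd y]; rfl
  have hΔ : ∀ y, σ ((Δ U) (σ.symm y)) = -(Δ U) y := fun y => by
    rw [← laplacian_conj_linearIsometryEquiv σ U y, hconj, InnerProductSpace.laplacian_neg]
    rfl
  have hD : ∀ y, σ (fderiv ℝ U (σ.symm y) (σ.symm y)) = -(fderiv ℝ U y y) := fun y => by
    have h1 : fderiv ℝ (fun z => σ (U (σ.symm z))) y y = σ (fderiv ℝ U (σ.symm y) (σ.symm y)) := by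
      rw [fderiv_conj_linearIsometryEquiv σ U y]; rfl
    rw [← h1, hconj, fderiv_neg]; rfl
  have hGodd : ∀ y, σ (G (σ.symm y)) = -G y := fun y => by
    simp only [hG, hzonal, smul_zero, add_zero, one_smul, map_add, map_neg, map_smul, hΔ, hD,
      hodd, smul_neg, neg_neg, neg_add]
  -- Step 2: curl G = 0, G = ∇ψ
  have hcurl : curl G = 0 := curl_eq_zero_of_odd_even_split σ hGb hQ hE hEc heqG hGodd heven
  obtain ⟨ψ, hψ, hgrad⟩ := exists_smooth_gradient_eq hGb.1 hcurl
  -- Step 3: G is tangential, hence zero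
  have htanD : ∀ y, ⟪fderiv ℝ U y y, y⟫ = 0 := inner_fderiv_self_eq_zero_of_tangential hUd htanU
  have htanG : ∀ y, ⟪G y, y⟫ = 0 := fun y => by
    simp only [hG, hzonal, smul_zero, add_zero, one_smul, inner_add_left, inner_neg_left,
      inner_smul_left, htanU y, htanΔ y, htanD y, mul_zero, neg_zero, add_zero, RCLike.conj_to_real]
  have hG0 : G = 0 := eq_zero_of_gradient_tangential hψ hgrad htanG
  -- Step 4: the linear profile equation with zero defect
  have hlin : ∀ y, -(Δ U) y + (1 / 2 : ℝ) • U y + (1 / 2 : ℝ) • fderiv ℝ U y y + α • angGen 2 U y +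
      gradient (fun _ : EuclideanSpace ℝ (Fin 3) => (0 : ℝ)) y =
        (0 : EuclideanSpace ℝ (Fin 3) → EuclideanSpace ℝ (Fin 3)) y := fun y => by
    have h0 := congrFun hG0 y
    simp only [hG, one_smul, Pi.zero_apply] at h0
    rw [gradient_fun_const, add_zero, Pi.zero_apply]
    exact h0
  exact eq_zero_of_linearProfile hU hdiv contDiff_const (isCobandLimited_zero_field L) hlin hdec

/-! ## §4 The swirl-only field `U = f·J`, `f` axisymmetric -/

variable {f : EuclideanSpace ℝ (Fin 3) → ℝ}

/-- `e₃ × v = Jv` in the tree's two spellings (`crossCLM (axis 2)` of the AGL files, `rotGen` of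
the axisymmetric Literature). [folklore] -/
theorem crossCLM_axis_two_eq_rotGen (v : EuclideanSpace ℝ (Fin 3)) :
    crossCLM (axis 2) v = rotGen v := by
  rw [crossCLM_apply]
  ext i
  fin_cases i <;> simp [cross, cross_apply, axis, rotGen]

/-- `⟪Jy, y⟫ = 0`. [folklore] -/
private theorem inner_rotGen_self' (y : EuclideanSpace ℝ (Fin 3)) : ⟪rotGen y, y⟫ = 0 := by
  have h := inner_rotGen_left_eq_neg y y
  rw [real_inner_comm (rotGen y) y] at h
  linarith

/-- `J(c v) = c Jv`. [folklore] -/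
private theorem rotGen_smul' (c : ℝ) (v : EuclideanSpace ℝ (Fin 3)) : rotGen (c • v) = c • rotGen v := by
  rw [← rotGenL_apply, map_smul, rotGenL_apply]

/-- `J(−v) = −Jv`. [folklore] -/
private theorem rotGen_neg' (v : EuclideanSpace ℝ (Fin 3)) : rotGen (-v) = -rotGen v := by
  rw [← rotGenL_apply, map_neg, rotGenL_apply]
/-- **The swirl-only field is zonal**: `J₃(fJ) = 0` for axisymmetric `f`. [folklore] -/
theorem angGen_two_smul_rotGen (hf : Differentiable ℝ f) (hax : IsAxisymmetricScalar f)
    (y : EuclideanSpace ℝ (Fin 3)) :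
    angGen 2 (fun x : EuclideanSpace ℝ (Fin 3) => f x • rotGen x) y = 0 := by
  rw [angGen_eq]
  simp only [crossCLM_axis_two_eq_rotGen, fderiv_smul_rotGen_apply (hf y), hax.fderiv_rotGen (hf y),
    zero_smul, zero_add, rotGen_smul', sub_self]

/-- **Centripetal self-advection**: `((fJ)·∇)(fJ)(y) = f(y)²·J(Jy)` for axisymmetric `f`.
[folklore] -/
theorem convect_smul_rotGen_self (hf : Differentiable ℝ f) (hax : IsAxisymmetricScalar f)
    (y : EuclideanSpace ℝ (Fin 3)) :
    convect (fun x : EuclideanSpace ℝ (Fin 3) => f x • rotGen x)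
        (fun x : EuclideanSpace ℝ (Fin 3) => f x • rotGen x) y = (f y) ^ 2 • rotGen (rotGen y) := by
  rw [convect_apply, fderiv_smul_rotGen_apply (hf y), map_smul, smul_eq_mul, hax.fderiv_rotGen (hf y),
    mul_zero, zero_smul, zero_add, rotGen_smul', smul_smul, pow_two]

/-- The swirl-only field is tangential: `⟪f(y)Jy, y⟫ = 0`. [folklore] -/
theorem inner_smul_rotGen_self (f : EuclideanSpace ℝ (Fin 3) → ℝ) (y : EuclideanSpace ℝ (Fin 3)) :
    ⟪f y • rotGen y, y⟫ = 0 := by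
  rw [inner_smul_left, inner_rotGen_self', mul_zero]

/-- **The Laplacian of the swirl-only field is tangential**: `⟪Δ(fJ)(y), y⟫ = 0` for
axisymmetric `f ∈ C²` (`Δ(fJ) = (Δf)J + 2J∇f`, `⟪J∇f, y⟫ = −⟪∇f, Jy⟫ = 0`). [folklore] -/
theorem inner_laplacian_smul_rotGen_self (hf : ContDiff ℝ 2 f) (hax : IsAxisymmetricScalar f)
    (y : EuclideanSpace ℝ (Fin 3)) :
    ⟪(Δ (fun x : EuclideanSpace ℝ (Fin 3) => f x • rotGen x)) y, y⟫ = 0 := by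
  have hd : DifferentiableAt ℝ f y := (hf.differentiable (by norm_num)) y
  rw [laplacian_smul_rotGen hf y, inner_add_left, inner_smul_left, inner_rotGen_self', mul_zero,
    zero_add, inner_smul_left, inner_rotGen_left_eq_neg, real_inner_comm,
    hax.inner_rotGen_gradient hd, neg_zero, mul_zero]

/-- Under a linear isometry `σ` anti-commuting with `J` (`σJσ⁻¹ = −J`) and fixing `f`
(`f ∘ σ⁻¹ = f`) the swirl-only field is ODD. [folklore] -/
theorem smul_rotGen_odd (σ : EuclideanSpace ℝ (Fin 3) ≃ₗᵢ[ℝ] EuclideanSpace ℝ (Fin 3))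
    (hσJ : ∀ v, σ (rotGen (σ.symm v)) = -rotGen v) (hσf : ∀ y, f (σ.symm y) = f y)
    (y : EuclideanSpace ℝ (Fin 3)) :
    σ ((fun x : EuclideanSpace ℝ (Fin 3) => f x • rotGen x) (σ.symm y)) = -(f y • rotGen y) := by
  simp only [map_smul, hσf, hσJ, smul_neg]

/-- … and its self-advection `f²J²` is EVEN. [folklore] -/
theorem convect_smul_rotGen_even (σ : EuclideanSpace ℝ (Fin 3) ≃ₗᵢ[ℝ] EuclideanSpace ℝ (Fin 3))
    (hσJ : ∀ v, σ (rotGen (σ.symm v)) = -rotGen v) (hσf : ∀ y, f (σ.symm y) = f y)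
    (hf : Differentiable ℝ f) (hax : IsAxisymmetricScalar f) (y : EuclideanSpace ℝ (Fin 3)) :
    σ (convect (fun x : EuclideanSpace ℝ (Fin 3) => f x • rotGen x)
        (fun x : EuclideanSpace ℝ (Fin 3) => f x • rotGen x) (σ.symm y)) =
      convect (fun x : EuclideanSpace ℝ (Fin 3) => f x • rotGen x)
        (fun x : EuclideanSpace ℝ (Fin 3) => f x • rotGen x) y := by
  have hJJ : σ (rotGen (rotGen (σ.symm y))) = rotGen (rotGen y) := by
    calc σ (rotGen (rotGen (σ.symm y)))
        = σ (rotGen (σ.symm (σ (rotGen (σ.symm y))))) := by rw [σ.symm_apply_apply]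
      _ = -rotGen (σ (rotGen (σ.symm y))) := hσJ _
      _ = rotGen (rotGen y) := by rw [hσJ, rotGen_neg', neg_neg]
  rw [convect_smul_rotGen_self hf hax, convect_smul_rotGen_self hf hax, map_smul, hσf, hJJ]

/-- **SWIRL-ONLY RUNG PROFILES ARE EXCLUDED (every `α`, every `L`).** Let `f` be smooth and
axisymmetric and `U(y) = f(y)·Jy` (`J y = e₃ × y`): if `U` is band-limited of degree `≤ L`,
divergence-free, solves `−ΔU + ½U + ½DU·y + αJ₃U + (U·∇)U + ∇Q = E` with smooth `Q` and
co-band-limited `E`, has the tail `‖U(y)‖ ≤ C/(‖y‖+1)`, and some linear isometry `σ` satisfies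
`σJσ⁻¹ = −J`, `f ∘ σ⁻¹ = f` (the reflection in a meridional plane does, for every axisymmetric
`f`), then `U ≡ 0`. [folklore] -/
theorem swirlOnly_eq_zero (σ : EuclideanSpace ℝ (Fin 3) ≃ₗᵢ[ℝ] EuclideanSpace ℝ (Fin 3))
    (hσJ : ∀ v, σ (rotGen (σ.symm v)) = -rotGen v) (hσf : ∀ y, f (σ.symm y) = f y)
    (hf : ContDiff ℝ ∞ f) (hax : IsAxisymmetricScalar f)
    (hU : IsBandLimited L (fun x : EuclideanSpace ℝ (Fin 3) => f x • rotGen x))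
    (hdiv : VectorCalculus.IsDivFree (fun x : EuclideanSpace ℝ (Fin 3) => f x • rotGen x))
    (hQ : ContDiff ℝ ∞ Q) (hE : IsCobandLimited L E) (hEc : Continuous E)
    (heq : ∀ y, -(Δ (fun x : EuclideanSpace ℝ (Fin 3) => f x • rotGen x)) y +
      (1 / 2 : ℝ) • (f y • rotGen y) +
      (1 / 2 : ℝ) • fderiv ℝ (fun x : EuclideanSpace ℝ (Fin 3) => f x • rotGen x) y y +
      α • angGen 2 (fun x : EuclideanSpace ℝ (Fin 3) => f x • rotGen x) y +
      convect (fun x : EuclideanSpace ℝ (Fin 3) => f x • rotGen x)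
        (fun x : EuclideanSpace ℝ (Fin 3) => f x • rotGen x) y + gradient Q y = E y)
    (hdec : ∀ y, ‖f y • rotGen y‖ ≤ C / (‖y‖ + 1)) :
    ∀ y : EuclideanSpace ℝ (Fin 3), f y • rotGen y = 0 := by
  have hfd : Differentiable ℝ f := hf.differentiable (by simp)
  have hf2 : ContDiff ℝ 2 f := contDiff_infty.1 hf 2
  have hz := eq_zero_of_reflectionOdd (U := fun x : EuclideanSpace ℝ (Fin 3) => f x • rotGen x)
    σ hU hdiv hQ hE hEc heq hdec (angGen_two_smul_rotGen hfd hax) (smul_rotGen_odd σ hσJ hσf)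
    (convect_smul_rotGen_even σ hσJ hσf hfd hax) (inner_smul_rotGen_self f)
    (inner_laplacian_smul_rotGen_self hf2 hax)
  intro y
  exact congrFun hz y

/-! ## §5 The meridian reflection `reflY (y₀, y₁, y₂) = (y₀, −y₁, y₂)` does the job -/

/-- `σJσ⁻¹ = −J` for the meridian reflection `σ = reflY`. [folklore] -/
theorem reflY_rotGen_reflY (v : EuclideanSpace ℝ (Fin 3)) :
    reflY (rotGen (reflY.symm v)) = -rotGen v := by
  rw [reflY_symm]
  ext i
  fin_cases i <;> simp [rotGen]

/-- An axisymmetric scalar is invariant under the meridian reflection (`σ x = R_{−2φ} x` off the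
axis, `σ x = x` on it). [folklore] -/
theorem _root_.Literature.Analysis.FluidPDE.IsAxisymmetricScalar.comp_reflY_symm
    (hax : IsAxisymmetricScalar f) (y : EuclideanSpace ℝ (Fin 3)) : f (reflY.symm y) = f y := by
  rw [reflY_symm]
  by_cases hy : cylRadius y = 0
  · obtain ⟨h0, h1⟩ := (cylRadius_eq_zero_iff y).1 hy
    have e : reflY y = y := by
      ext i
      fin_cases i <;> simp [h0, h1]
    rw [e]
  · obtain ⟨θ, -, -, hθ⟩ := exists_rotZ_eq_reflY hy
    rw [← hθ, hax θ y]

/-- **SWIRL-ONLY RUNG PROFILES ARE EXCLUDED — unconditional form.** For `f` smooth and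
axisymmetric, the toroidal zonal field `U(y) = f(y)·(−y₁, y₀, 0)` cannot be a non-trivial
precessing rung profile: band-limited of degree `≤ L`, divergence-free, co-band continuous defect,
`−ΔU + ½U + ½DU·y + αJ₃U + (U·∇)U + ∇Q = E`, tail `‖U(y)‖ ≤ C/(‖y‖+1)` ⇒ `U ≡ 0` — every
`α`, every `L`, no window. [folklore] -/
theorem swirlOnly_eq_zero' (hf : ContDiff ℝ ∞ f) (hax : IsAxisymmetricScalar f)
    (hU : IsBandLimited L (fun x : EuclideanSpace ℝ (Fin 3) => f x • rotGen x))
    (hdiv : VectorCalculus.IsDivFree (fun x : EuclideanSpace ℝ (Fin 3) => f x • rotGen x))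
    (hQ : ContDiff ℝ ∞ Q) (hE : IsCobandLimited L E) (hEc : Continuous E)
    (heq : ∀ y, -(Δ (fun x : EuclideanSpace ℝ (Fin 3) => f x • rotGen x)) y +
      (1 / 2 : ℝ) • (f y • rotGen y) +
      (1 / 2 : ℝ) • fderiv ℝ (fun x : EuclideanSpace ℝ (Fin 3) => f x • rotGen x) y y +
      α • angGen 2 (fun x : EuclideanSpace ℝ (Fin 3) => f x • rotGen x) y +
      convect (fun x : EuclideanSpace ℝ (Fin 3) => f x • rotGen x)
        (fun x : EuclideanSpace ℝ (Fin 3) => f x • rotGen x) y + gradient Q y = E y)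
    (hdec : ∀ y, ‖f y • rotGen y‖ ≤ C / (‖y‖ + 1)) :
    ∀ y : EuclideanSpace ℝ (Fin 3), f y • rotGen y = 0 :=
  swirlOnly_eq_zero reflY reflY_rotGen_reflY hax.comp_reflY_symm hf hax hU hdiv hQ hE hEc heq hdec

/-- **Unconditional form in the letters of `IsPrecessingRungProfile L α C U Q E`** (with
`U y = f y • (−y₁, y₀, 0)`, `f` smooth axisymmetric). [folklore] -/
theorem rungProfile_swirlOnly_eq_zero (hf : ContDiff ℝ ∞ f) (hax : IsAxisymmetricScalar f)
    (hUf : ∀ y, U y = f y • rotGen y)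
    (hU : IsBandLimited L U) (hdiv : VectorCalculus.IsDivFree U)
    (hQ : ContDiff ℝ ∞ Q) (hEc : Continuous E) (hE : IsCobandLimited L E)
    (hres : ∀ y, -(Δ U) y + (1 / 2 : ℝ) • U y + (1 / 2 : ℝ) • fderiv ℝ U y y + α • angGen 2 U y +
      convect U U y + gradient Q y - E y = 0)
    (hdec : ∀ y, ‖U y‖ ≤ C / (‖y‖ + 1)) : ∀ y, U y = 0 := by
  have hUe : U = fun x => f x • rotGen x := funext hUf
  subst hUe
  exact swirlOnly_eq_zero' hf hax hU hdiv hQ hE hEc (fun y => sub_eq_zero.1 (hres y)) hdec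

end Summit.NavierStokesRegularity.AngularGalerkinLadderSwirlOnlyProfilesExcluded

end
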